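import Summits.QuantumFields.QCD.Theses.SpectralDefectExtinction
import Summits.QuantumFields.QCD.Theorems.SpectralDefectExtinctionTipPricingStubTightOfMoments

/-!
# Quantitative (intensive) form of the TIGHT format of line `tight-from-two-moments`
(crux `Summit.QuantumFields.QCD.Theses.SpectralDefectExtinction.TipPricing`, item stmt-QuantumFields-8967;
helper file, `--supports`)

**What is proved (sorry-free, no named facts).** The Hölder `(3/2, 3)` step of the line, kept
QUANTITATIVE: for a weight `w ≥ 0` and a real observable `q` (all `|q|^j w` integrable), a
second-moment FLOOR `χ₀ · V · ∫w ≤ ∫ q² w` and a fourth-moment CAP `(∫ q⁴ w)(∫ w) ≤ K₄ (∫ q² w)²`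
(`χ₀, V, K₄ > 0`, `∫ w > 0`) give
`√(χ₀ V / K₄) ≤ ∫ |q| w / ∫ w` (`intensiveTight_core`, `intensiveTight_abstract` for a counting
observable), and the instance on the literal route terms (`intensiveTight_of_indexMoments`): on the torus
of side `L` at coupling `β`, weight `w(U) = ∏_f |det D_W(U, mq_f, 1)|`, index observable
`q(U) = #{roots of charpoly(Γ₅ D_W(U, m₀, 1)) with Re < 0} − n₀`, Wilson measure.  With
`V = (a_k(2L_k+1))⁴` this is `E₊|Q_k| ≥ √(χ₀/K₄) · (a_k(2L_k+1))²`: the INTENSIVE form of TIGHT that the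
triage panel, both disprovers and both line leads recommend as the repair of the hinge item 8964
(`E₊|Q| ≥ c · (a_k(2L_k+1))²`, killing the free-volume junk witness) follows from the SAME two stubs
(`stub_lineExtinctFloor`, `stub_kurtosisCap`) of this line with `c = √(χ₀/K₄)` — no change of stubs, as
claimed in the line card ("Dead lines avoided").  Proof: Cauchy–Schwarz twice
(`tightOfMoments_cauchySchwarz`, landed p98847) gives `B³ ≤ A² K` (`A = ∫|q|w`, `B = ∫q²w`, `K = ∫q⁴w`);
with the cap `K Z ≤ K₄ B²` and `B > 0`: `B Z ≤ K₄ A²`; with the floor: `χ₀ V Z² ≤ K₄ A²`.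
-/

noncomputable section

namespace Summit.QuantumFields.QCD.Cruxes.TipPricing.TightFromTwoMoments

open scoped BigOperators Topology Classical
open MeasureTheory Filter
open Literature.MathematicalPhysics.QuantumLattice Literature.MathematicalPhysics.QuantumFieldTheory
  Literature.Probability.LatticeModels
open Summit.QuantumFields.QCD.Theses.SpectralDefectExtinction
open Summit.QuantumFields.QCD.Cruxes.TipPricing.HermitianFlowCoarea
open Summit.QuantumFields.QCD.Cruxes.WindowExtinction.FreeVolumeHeavyWitness

/-- **Intensive Hölder step, abstract form.** For a weight `w ≥ 0` and a real observable `q` with every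
`|q|^j w` integrable: `∫ w > 0`, the floor `χ₀ V ∫w ≤ ∫ q² w` and the cap `(∫ q⁴ w)(∫ w) ≤ K₄ (∫ q² w)²`
with `χ₀, V, K₄ > 0` imply `√(χ₀ V / K₄) ≤ ∫ |q| w / ∫ w`. -/
theorem intensiveTight_core {X : Type*} [MeasurableSpace X] {μ : Measure X} {q w : X → ℝ}
    {χ₀ V K₄ : ℝ} (hw0 : ∀ x, 0 ≤ w x) (hI : ∀ j : ℕ, Integrable (fun x => |q x| ^ j * w x) μ)
    (hZ : 0 < ∫ x, w x ∂μ) (hχ₀ : 0 < χ₀) (hV : 0 < V) (hK₄ : 0 < K₄)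
    (hfloor : χ₀ * V * (∫ x, w x ∂μ) ≤ ∫ x, q x ^ 2 * w x ∂μ)
    (hcap : (∫ x, q x ^ 4 * w x ∂μ) * (∫ x, w x ∂μ) ≤ K₄ * (∫ x, q x ^ 2 * w x ∂μ) ^ 2) :
    Real.sqrt (χ₀ * V / K₄) ≤ (∫ x, |q x| * w x ∂μ) / ∫ x, w x ∂μ := by
  have hI1 : Integrable (fun x => |q x| * w x) μ := by simpa only [pow_one] using hI 1
  have hI2 : Integrable (fun x => q x ^ 2 * w x) μ := by simpa only [sq_abs] using hI 2
  have hI4 : Integrable (fun x => q x ^ 4 * w x) μ := by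
    simpa only [Even.pow_abs (by decide : Even 4)] using hI 4
  -- Cauchy–Schwarz twice
  have cs1 : (∫ x, q x ^ 2 * w x ∂μ) ^ 2 ≤ (∫ x, |q x| * w x ∂μ) * ∫ x, |q x| ^ 3 * w x ∂μ :=
    tightOfMoments_cauchySchwarz (fun _ => 1) (fun x => |q x|) (fun x => |q x| * w x)
      (fun x => mul_nonneg (abs_nonneg _) (hw0 x)) (fun x => by ring) (fun x => by ring)
      (fun x => by rw [← sq_abs]; ring) hI1 (hI 3) hI2
  have cs2 : (∫ x, |q x| ^ 3 * w x ∂μ) ^ 2 ≤ (∫ x, q x ^ 2 * w x ∂μ) * ∫ x, q x ^ 4 * w x ∂μ :=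
    tightOfMoments_cauchySchwarz (fun x => |q x|) (fun x => q x ^ 2) w hw0
      (fun x => by rw [sq_abs]) (fun x => by ring) (fun x => by rw [← sq_abs]; ring) hI2 hI4 (hI 3)
  set Z := ∫ x, w x ∂μ with hZdef
  set A := ∫ x, |q x| * w x ∂μ with hAdef
  set B := ∫ x, q x ^ 2 * w x ∂μ with hBdef
  set T := ∫ x, |q x| ^ 3 * w x ∂μ with hTdef
  set K := ∫ x, q x ^ 4 * w x ∂μ with hKdef
  have hA0 : 0 ≤ A := integral_nonneg fun x => mul_nonneg (abs_nonneg _) (hw0 x)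
  have hB : 0 < B := lt_of_lt_of_le (by positivity) hfloor
  -- `B⁴ ≤ A² T² ≤ A² B K`, so `B³ ≤ A² K`
  have h1 : B ^ 3 ≤ A ^ 2 * K := by
    have h4 : B ^ 4 ≤ A ^ 2 * (B * K) :=
      calc B ^ 4 = (B ^ 2) ^ 2 := by ring
        _ ≤ (A * T) ^ 2 := pow_le_pow_left₀ (sq_nonneg _) cs1 2
        _ = A ^ 2 * T ^ 2 := by ring
        _ ≤ A ^ 2 * (B * K) := mul_le_mul_of_nonneg_left cs2 (sq_nonneg _)
    refine le_of_mul_le_mul_left ?_ hB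
    calc B * B ^ 3 = B ^ 4 := by ring
      _ ≤ A ^ 2 * (B * K) := h4
      _ = B * (A ^ 2 * K) := by ring
  -- `B³ Z ≤ A² K Z ≤ A² K₄ B²`, so `B Z ≤ K₄ A²`
  have h2 : B * Z ≤ K₄ * A ^ 2 := by
    have h5 : B ^ 2 * (B * Z) ≤ B ^ 2 * (K₄ * A ^ 2) :=
      calc B ^ 2 * (B * Z) = B ^ 3 * Z := by ring
        _ ≤ A ^ 2 * K * Z := mul_le_mul_of_nonneg_right h1 hZ.le
        _ = A ^ 2 * (K * Z) := by ring
        _ ≤ A ^ 2 * (K₄ * B ^ 2) := mul_le_mul_of_nonneg_left hcap (sq_nonneg _)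
        _ = B ^ 2 * (K₄ * A ^ 2) := by ring
    exact le_of_mul_le_mul_left h5 (by positivity)
  -- with the floor: `χ₀ V Z² ≤ K₄ A²`, i.e. `χ₀ V / K₄ ≤ (A/Z)²`
  have h3 : χ₀ * V / K₄ ≤ (A / Z) ^ 2 := by
    rw [div_pow, div_le_div_iff₀ hK₄ (pow_pos hZ 2)]
    calc χ₀ * V * Z ^ 2 = (χ₀ * V * Z) * Z := by ring
      _ ≤ B * Z := mul_le_mul_of_nonneg_right hfloor hZ.le
      _ ≤ K₄ * A ^ 2 := h2
      _ = A ^ 2 * K₄ := mul_comm _ _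
  calc Real.sqrt (χ₀ * V / K₄) ≤ Real.sqrt ((A / Z) ^ 2) := Real.sqrt_le_sqrt h3
    _ = A / Z := Real.sqrt_sq (div_nonneg hA0 hZ.le)

/-- **Intensive Hölder step for a counting observable.** On a finite measure space, for a measurable
bounded count `N`, a real offset `n₀` and a bounded a.e.-strongly measurable weight `w ≥ 0`:
`∫ w > 0`, `χ₀ V ∫w ≤ ∫ (N − n₀)² w` and `(∫ (N − n₀)⁴ w)(∫ w) ≤ K₄ (∫ (N − n₀)² w)²` (`χ₀, V, K₄ > 0`)
imply `√(χ₀ V / K₄) ≤ ∫ |N − n₀| w / ∫ w`. -/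
theorem intensiveTight_abstract {X : Type*} [MeasurableSpace X] {μ : Measure X}
    [IsFiniteMeasure μ] {N : X → ℕ} {w : X → ℝ} {C D χ₀ V K₄ : ℝ} (n₀ : ℝ) (hN : Measurable N)
    (hNC : ∀ x, (N x : ℝ) ≤ C) (hw : AEStronglyMeasurable w μ) (hwD : ∀ x, ‖w x‖ ≤ D)
    (hw0 : ∀ x, 0 ≤ w x) (hZ : 0 < ∫ x, w x ∂μ) (hχ₀ : 0 < χ₀) (hV : 0 < V) (hK₄ : 0 < K₄)
    (hfloor : χ₀ * V * (∫ x, w x ∂μ) ≤ ∫ x, ((N x : ℝ) - n₀) ^ 2 * w x ∂μ)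
    (hcap : (∫ x, ((N x : ℝ) - n₀) ^ 4 * w x ∂μ) * (∫ x, w x ∂μ) ≤
      K₄ * (∫ x, ((N x : ℝ) - n₀) ^ 2 * w x ∂μ) ^ 2) :
    Real.sqrt (χ₀ * V / K₄) ≤ (∫ x, |(N x : ℝ) - n₀| * w x ∂μ) / ∫ x, w x ∂μ := by
  have hqm : Measurable fun x => ((N x : ℝ) - n₀) := (measurable_from_nat.comp hN).sub_const n₀
  have hqC : ∀ x, |(N x : ℝ) - n₀| ≤ C + |n₀| := fun x =>
    (abs_sub _ _).trans (add_le_add ((Nat.abs_cast _).trans_le (hNC x)) le_rfl)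
  have hI : ∀ j : ℕ, Integrable (fun x => |(N x : ℝ) - n₀| ^ j * w x) μ := by
    intro j
    refine Integrable.of_bound
      (((continuous_abs.measurable.comp hqm).pow_const j).aestronglyMeasurable.mul hw)
      ((C + |n₀|) ^ j * D) (Eventually.of_forall fun x => ?_)
    rw [norm_mul, norm_pow, Real.norm_eq_abs, abs_abs]
    exact mul_le_mul (pow_le_pow_left₀ (abs_nonneg _) (hqC x) j) (hwD x) (norm_nonneg _)
      (pow_nonneg ((abs_nonneg _).trans (hqC x)) j)
  exact intensiveTight_core hw0 hI hZ hχ₀ hV hK₄ hfloor hcap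

/-- **The intensive TIGHT format on the literal route terms.** On the torus of side `L` at coupling `β`,
with the phase-quenched weight `w(U) = ∏_f |det D_W(U, mq_f, 1)|`, the index observable
`q(U) = #{roots of charpoly(Γ₅ D_W(U, m₀, 1)) with Re < 0} − n₀` (any real offset `n₀`) and the Wilson
measure: if `Z = ∫ w > 0`, `χ₀ V Z ≤ ∫ q² w` (floor) and `(∫ q⁴ w) Z ≤ K₄ (∫ q² w)²` (cap) with
`χ₀, V, K₄ > 0`, then `√(χ₀ V / K₄) ≤ ∫ |q| w / Z`.  With `V = (a_k(2L_k+1))⁴` at step `k` of a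
regularisation this reads `E₊|Q_k| ≥ √(χ₀/K₄) · (a_k(2L_k+1))²` — the intensive (repaired) TIGHT clause from the
line's floor and cap.  The count is measurable (`stub_negCountMeasurable`) and bounded by the dimension
(`extinctOfDOS_countP_le`), the weight continuous and bounded (`extinctOfDOS_weight`), the Wilson measure a
probability measure (`isProbabilityMeasure_wilsonMeasure`). -/
theorem intensiveTight_of_indexMoments :
    ∀ (Nf L : ℕ) [NeZero L] (β m₀ n₀ χ₀ V K₄ : ℝ) (mq : Fin Nf → ℝ), 0 < χ₀ → 0 < V → 0 < K₄ →
      0 < (∫ U, ∏ f : Fin Nf, ‖fermionDet (wilsonDirac (fundamentalRep (Fin 3)) U (mq f) 1)‖ ∂(wilsonMeasure (fundamentalRep (Fin 3)) β : Measure (GaugeConfig 4 L SU3))) →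
      χ₀ * V * (∫ U, ∏ f : Fin Nf, ‖fermionDet (wilsonDirac (fundamentalRep (Fin 3)) U (mq f) 1)‖ ∂(wilsonMeasure (fundamentalRep (Fin 3)) β : Measure (GaugeConfig 4 L SU3)))
        ≤ (∫ U, ((Multiset.countP (fun z : ℂ => z.re < 0) (spinorLift gammaFive * wilsonDirac (fundamentalRep (Fin 3)) U m₀ 1).charpoly.roots : ℝ) - n₀) ^ 2 * ∏ f : Fin Nf, ‖fermionDet (wilsonDirac (fundamentalRep (Fin 3)) U (mq f) 1)‖ ∂(wilsonMeasure (fundamentalRep (Fin 3)) β : Measure (GaugeConfig 4 L SU3))) →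
      (∫ U, ((Multiset.countP (fun z : ℂ => z.re < 0) (spinorLift gammaFive * wilsonDirac (fundamentalRep (Fin 3)) U m₀ 1).charpoly.roots : ℝ) - n₀) ^ 4 * ∏ f : Fin Nf, ‖fermionDet (wilsonDirac (fundamentalRep (Fin 3)) U (mq f) 1)‖ ∂(wilsonMeasure (fundamentalRep (Fin 3)) β : Measure (GaugeConfig 4 L SU3)))
          * (∫ U, ∏ f : Fin Nf, ‖fermionDet (wilsonDirac (fundamentalRep (Fin 3)) U (mq f) 1)‖ ∂(wilsonMeasure (fundamentalRep (Fin 3)) β : Measure (GaugeConfig 4 L SU3)))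
        ≤ K₄ * (∫ U, ((Multiset.countP (fun z : ℂ => z.re < 0) (spinorLift gammaFive * wilsonDirac (fundamentalRep (Fin 3)) U m₀ 1).charpoly.roots : ℝ) - n₀) ^ 2 * ∏ f : Fin Nf, ‖fermionDet (wilsonDirac (fundamentalRep (Fin 3)) U (mq f) 1)‖ ∂(wilsonMeasure (fundamentalRep (Fin 3)) β : Measure (GaugeConfig 4 L SU3))) ^ 2 →
      Real.sqrt (χ₀ * V / K₄) ≤ (∫ U, (|(Multiset.countP (fun z : ℂ => z.re < 0) (spinorLift gammaFive * wilsonDirac (fundamentalRep (Fin 3)) U m₀ 1).charpoly.roots : ℝ) - n₀|) * ∏ f : Fin Nf, ‖fermionDet (wilsonDirac (fundamentalRep (Fin 3)) U (mq f) 1)‖ ∂(wilsonMeasure (fundamentalRep (Fin 3)) β : Measure (GaugeConfig 4 L SU3)))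
          / (∫ U, ∏ f : Fin Nf, ‖fermionDet (wilsonDirac (fundamentalRep (Fin 3)) U (mq f) 1)‖ ∂(wilsonMeasure (fundamentalRep (Fin 3)) β : Measure (GaugeConfig 4 L SU3))) := by
  intro Nf L _ β m₀ n₀ χ₀ V K₄ mq hχ₀ hV hK₄ hZ hfloor hcap
  haveI : IsProbabilityMeasure (wilsonMeasure (d := 4) (L := L) (fundamentalRep (Fin 3)) β) :=
    isProbabilityMeasure_wilsonMeasure _ (continuous_fundamentalRep (Fin 3)) β
  obtain ⟨hwc, D, hD⟩ := extinctOfDOS_weight (L := L) mq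
  exact intensiveTight_abstract n₀ (stub_negCountMeasurable L m₀)
    (fun U => extinctOfDOS_countP_le _ _) hwc.aestronglyMeasurable hD
    (fun U => Finset.prod_nonneg fun f _ => norm_nonneg _) hZ hχ₀ hV hK₄ hfloor hcap

end Summit.QuantumFields.QCD.Cruxes.TipPricing.TightFromTwoMoments

end
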